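import Mathlib.Probability.Distributions.Uniform
import Mathlib.Probability.ProbabilityMassFunction.Constructions
import Mathlib.Data.Fintype.Pi
import Mathlib.Data.Fintype.Vector
import Mathlib.Computability.Encoding
import Literature.Computability.Complexity.BoolEncodings
import Literature.Computability.Complexity.Randomized
import Literature.Computability.Complexity.Oracle
import HarnessLib

-- provenance: harness21/H21/H21/Prelude/CryptoQuantFine/OracleGames.lean @ 7f20f4c (interim HEAD d8f2665); M5 mechanical rewrite
/-!
# Crypto / quantum / fine-grained prelude: oracle-access games

Trunk `CryptoQuantFine`, concept C4a (`OracleGames`; glue for the notions `prf_definition` and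
`crypto_scheme_definitions`, for `QAOracles` and for G10's PQC files). This file only depends on
the complexity core (G01: `Oracle`, `Randomized`, `BoolEncodings`) — deliberately **no crypto
imports** — so that `Literature.Statements.PQC.LWEHardness` can import it.

Contents:

* `Literature.Computability.Complexity.OracleAlg.randRun` — the output law of G01's *deterministic* transcript
  algorithm `OracleAlg` run with uniformly random coins (a randomised oracle algorithm is a
  deterministic one reading its coins from the second `boolPair` component of its input), and
  `OracleAlg.randQueriesPMF`, the law of its query transcript.
* `Literature.CplxCore.OracleAlg.runIdxAux / runIdx / queriesIdxAux / queriesIdx` — the *indexed*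
  runner: the `i`-th query is answered by `O i` (models stateful / randomised oracles such as
  encryption or signing oracles using fresh coins per query); `runIdx_const` recovers `run`.
* `OracleAdversary β` — an oracle algorithm bundled with polynomial coin and round budgets;
  `IsPPT`, `outputPMF`, `outputPMFIdx`, `acceptProb` (mass of `some true` on input `1ⁿ`).
* Oracle builders `oracleOfFnAt`, `oracleOfTable`, and the uniformly random function
  `randomFunctionPMF a b` on `{0,1}^a → {0,1}^b` (the ideal object of the PRF game).

Mathlib anchors used (not redefined; searched `uniformOfFintype`, `PMF.map`, `Vector.fintype`,
`Pi.fintype`, `unaryEncodeNat`): `PMF`, `PMF.map`, `PMF.uniformOfFintype`,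
`PMF.coe_le_one`, `Computability.unaryEncodeNat`, `List.Vector`, the instances
`Vector.fintype`, `Pi.instFintype`/`Pi.instNonempty`. Mathlib has no oracle games, adversaries
or random-oracle constructions.

## Design notes

* `OracleAlg.randRun`, `randQueriesPMF`, `runIdxAux`, `runIdx`, `queriesIdxAux`, `queriesIdx`
  and `runIdx_const` are **deliberate dot-notation extensions** placed in
  `namespace Literature.CplxCore` (G01's namespace); everything else lives in
  `namespace Literature.CryptoQuantFine`.
* `OracleAlg.randRun` is the **canonical home** of the randomised runner; it is identical
  (name, namespace, signature, body) to the LOCAL GLUE copy in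
  `H21/Statements/PQC/LWEHardness.lean`, which is to be deleted by the supervisor (that file
  should then `import Literature.Prelude.CryptoQuantFine.OracleGames`). Until then no file may import
  both this file and `Literature.Statements.PQC.LWEHardness`.
* `Oracle` is an `abbrev` for `List Bool → List Bool`, so the oracle builders are plain
  functions (`oracleOfFnAt`, `oracleOfTable`); no dot-notation on `Oracle` is claimed.
* `oracleOfFnAt m h` / `oracleOfTable H` answer ill-formed queries (wrong length) by the empty
  string `[]` (documented junk value; adversaries in the PRF game only gain nothing from it).
* `acceptProb` feeds the adversary the security parameter in unary, `unaryEncodeNat n = 1ⁿ`,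
  as in Goldreich's oracle-indistinguishability games.

## References

* S. Arora, B. Barak, *Computational Complexity: A Modern Approach*, CUP 2009, Def. 7.1 with
  §3.4 (`BPP^O`: probabilistic oracle machines as deterministic ones with a random tape).
* O. Goldreich, *Foundations of Cryptography I*, CUP 2001, §3.6 (Def. 3.6.4, oracle machines
  distinguishing function ensembles; the uniform function ensemble).
* O. Goldreich, *Foundations of Cryptography II*, CUP 2004, §5.4 (CPA/CCA: encryption oracles
  with fresh coins per query), §6.1 (signing oracles, chosen-message attacks).
* O. Goldreich, S. Goldwasser, S. Micali, *How to construct random functions*, J. ACM 33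
  (1986), §3 (oracle access to a random function).
-/

namespace Literature.Computability.Cryptography

open _root_.Computability

variable {β : Type}

/-! ### Randomised runs of oracle algorithms (dot-extensions of `Literature.Computability.Complexity.OracleAlg`) -/

/-- The output law of the oracle algorithm `M` with oracle `O` on input `x`, *run with random
coins*: draw `r` uniformly from `{0,1}^{coins(|x|)}` and run `M` deterministically on
`boolPair x r` for `fuel(|x|)` rounds. So a randomised oracle algorithm is a deterministic
`OracleAlg` reading its coins from the second component of its input, and it is polynomial-time
when `M.IsPolyTime` (coins and fuel being polynomials). Deliberate dot-notation extension of
`Literature.Computability.Complexity.OracleAlg`. **Canonical home; the copy in `Statements/PQC/LWEHardness.lean` is to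
be deleted by the supervisor and that file should import this one.**
[Arora–Barak 2009, Def. 7.1 with §3.4 (`BPP^O`); Regev 2009, §4 (probabilistic reductions with
an LWE oracle)] [cite: AroraBarak2009, Def. 7.1 with §3.4 ( BPP^O] -/
noncomputable def _root_.Literature.Computability.Complexity.OracleAlg.randRun {β : Type} (M : Complexity.OracleAlg β) (O : Complexity.Oracle)
    (coins fuel : Polynomial ℕ) (x : List Bool) : PMF (Option β) :=
  (PMF.uniformOfFintype (List.Vector Bool (coins.eval x.length))).map
    fun r => M.run O (fuel.eval x.length) (Complexity.boolPair x r.toList)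

/-- The law of the query transcript of `M` with oracle `O` on input `x` run with uniformly
random coins `r ∈ {0,1}^{coins(|x|)}` for `fuel(|x|)` rounds (same coins as `randRun`).
Deliberate dot-notation extension of `Literature.Computability.Complexity.OracleAlg`.
[Arora–Barak 2009, §3.4 with Def. 7.1] [cite: AroraBarak2009, §3.4 with Def. 7.1] -/
noncomputable def _root_.Literature.Computability.Complexity.OracleAlg.randQueriesPMF {β : Type} (M : Complexity.OracleAlg β) (O : Complexity.Oracle)
    (coins fuel : Polynomial ℕ) (x : List Bool) : PMF (List (List Bool)) :=
  (PMF.uniformOfFintype (List.Vector Bool (coins.eval x.length))).map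
    fun r => M.queries O (fuel.eval x.length) (Complexity.boolPair x r.toList)

/-- Unfolding lemma for `randRun`. [Arora–Barak 2009, Def. 7.1] [cite: AroraBarak2009, Def. 7.1] -/
theorem _root_.Literature.Computability.Complexity.OracleAlg.randRun_eq_map (M : Complexity.OracleAlg β) (O : Complexity.Oracle) (coins fuel : Polynomial ℕ)
    (x : List Bool) :
    M.randRun O coins fuel x =
      (PMF.uniformOfFintype (List.Vector Bool (coins.eval x.length))).map
        fun r => M.run O (fuel.eval x.length) (Complexity.boolPair x r.toList) :=
  rfl

/-! ### Indexed runs (stateful / randomised oracles) -/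

section OracleAlg
open Literature.Computability.Complexity (OracleAlg)
open Literature.Computability.Complexity.OracleAlg

/-- Fuel-indexed *indexed* runner: like `OracleAlg.runAux`, but the `i`-th query (counting from
`0`, `i = answers.length` = number of answers received so far) is answered by `O i`. This models
oracles whose answers depend on the query number — stateful oracles, or randomised oracles
(encryption / signing oracles) whose `i`-th call uses the `i`-th block of fresh coins.
Deliberate dot-notation extension of `Literature.Computability.Complexity.OracleAlg`.
[Goldreich 2004, §5.4.1 (encryption oracle in CPA), §6.1.3 (signing oracle); Arora–Barak 2009,
§3.4] [cite: Goldreich2004, §5.4.1 (encryption oracle in CPA] -/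
def _root_.Literature.Computability.Complexity.OracleAlg.runIdxAux (M : OracleAlg β) (O : ℕ → List Bool → List Bool) (x : List Bool) :
    ℕ → List (List Bool) → Option β
  | 0, _ => none
  | k + 1, answers =>
    match M.step x answers with
    | Sum.inl q => runIdxAux M O x k (answers ++ [O answers.length q])
    | Sum.inr b => some b

/-- `M.runIdx O k x`: the output of `M` on input `x` within `k` rounds when the `i`-th query is
answered by the oracle `O i`, or `none` if no output is produced within the budget.
Deliberate dot-notation extension of `Literature.Computability.Complexity.OracleAlg`.
[Goldreich 2004, §5.4.1, §6.1.3; Arora–Barak 2009, §3.4] [cite: Goldreich2004, §5.4.1  §6.1.3] -/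
def _root_.Literature.Computability.Complexity.OracleAlg.runIdx (M : OracleAlg β) (O : ℕ → List Bool → List Bool) (k : ℕ) (x : List Bool) :
    Option β :=
  M.runIdxAux O x k []

/-- Fuel-indexed transcript of the indexed runner: the queries asked by `M` on input `x` when
continued from `answers`, the `i`-th query being answered by `O i`.
Deliberate dot-notation extension of `Literature.Computability.Complexity.OracleAlg`. [Goldreich 2004, §5.4.1] [cite: Goldreich2004, §5.4.1] -/
def _root_.Literature.Computability.Complexity.OracleAlg.queriesIdxAux (M : OracleAlg β) (O : ℕ → List Bool → List Bool) (x : List Bool) :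
    ℕ → List (List Bool) → List (List Bool)
  | 0, _ => []
  | k + 1, answers =>
    match M.step x answers with
    | Sum.inl q => q :: queriesIdxAux M O x k (answers ++ [O answers.length q])
    | Sum.inr _ => []

/-- `M.queriesIdx O k x`: the transcript of queries asked by `M` on input `x` within `k` rounds
of the indexed run (the `i`-th query answered by `O i`), in order.
Deliberate dot-notation extension of `Literature.Computability.Complexity.OracleAlg`. [Goldreich 2004, §5.4.1, §6.1.3
(the set of queries `Q` in CMA security)] [cite: Goldreich2004, §5.4.1  §6.1.3 (the set of queries  Q  i] -/
def _root_.Literature.Computability.Complexity.OracleAlg.queriesIdx (M : OracleAlg β) (O : ℕ → List Bool → List Bool) (k : ℕ) (x : List Bool) :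
    List (List Bool) :=
  M.queriesIdxAux O x k []

/-- With a query-number-independent oracle the indexed runner is G01's runner (auxiliary,
fuel-indexed form). [Arora–Barak 2009, §3.4] [cite: AroraBarak2009, §3.4] -/
theorem _root_.Literature.Computability.Complexity.OracleAlg.runIdxAux_const (M : OracleAlg β) (O : Complexity.Oracle) (x : List Bool) (k : ℕ)
    (answers : List (List Bool)) :
    M.runIdxAux (fun _ => O) x k answers = M.runAux O x k answers := by
  induction k generalizing answers with
  | zero => rfl
  | succ k ih =>
    simp only [runIdxAux, runAux]
    cases M.step x answers with
    | inl q => exact ih _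
    | inr b => rfl

/-- With a query-number-independent oracle the indexed run is G01's `run`:
`M.runIdx (fun _ => O) k x = M.run O k x`. [Arora–Barak 2009, §3.4] [cite: AroraBarak2009, §3.4] -/
@[simp] theorem _root_.Literature.Computability.Complexity.OracleAlg.runIdx_const (M : OracleAlg β) (O : Complexity.Oracle) (k : ℕ) (x : List Bool) :
    M.runIdx (fun _ => O) k x = M.run O k x :=
  M.runIdxAux_const O x k []

/-- With a query-number-independent oracle the indexed transcript is G01's transcript
(auxiliary form). [Arora–Barak 2009, §3.4] [cite: AroraBarak2009, §3.4] -/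
theorem _root_.Literature.Computability.Complexity.OracleAlg.queriesIdxAux_const (M : OracleAlg β) (O : Complexity.Oracle) (x : List Bool) (k : ℕ)
    (answers : List (List Bool)) :
    M.queriesIdxAux (fun _ => O) x k answers = M.queriesAux O x k answers := by
  induction k generalizing answers with
  | zero => rfl
  | succ k ih =>
    simp only [queriesIdxAux, queriesAux]
    cases M.step x answers with
    | inl q => exact congrArg _ (ih _)
    | inr b => rfl

/-- `M.queriesIdx (fun _ => O) k x = M.queries O k x`. [Arora–Barak 2009, §3.4] [cite: AroraBarak2009, §3.4] -/
@[simp] theorem _root_.Literature.Computability.Complexity.OracleAlg.queriesIdx_const (M : OracleAlg β) (O : Complexity.Oracle) (k : ℕ) (x : List Bool) :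
    M.queriesIdx (fun _ => O) k x = M.queries O k x :=
  M.queriesIdxAux_const O x k []

/-- At most `k` queries are asked within `k` rounds of the indexed run.
[Arora–Barak 2009, §3.4] [cite: AroraBarak2009, §3.4] -/
theorem _root_.Literature.Computability.Complexity.OracleAlg.length_queriesIdxAux_le (M : OracleAlg β) (O : ℕ → List Bool → List Bool)
    (x : List Bool) (k : ℕ) (answers : List (List Bool)) :
    (M.queriesIdxAux O x k answers).length ≤ k := by
  induction k generalizing answers with
  | zero => simp [queriesIdxAux]
  | succ k ih =>
    unfold queriesIdxAux
    cases M.step x answers with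
    | inl q => simpa using ih _
    | inr b => simp

/-- The indexed transcript within `k` rounds has at most `k` queries. [Arora–Barak 2009, §3.4] [cite: AroraBarak2009, §3.4] -/
theorem _root_.Literature.Computability.Complexity.OracleAlg.length_queriesIdx_le (M : OracleAlg β) (O : ℕ → List Bool → List Bool) (k : ℕ)
    (x : List Bool) : (M.queriesIdx O k x).length ≤ k :=
  M.length_queriesIdxAux_le O x k []

end OracleAlg

end Literature.Computability.Cryptography

namespace Literature.Computability.Cryptography

open _root_.Computability Complexity

variable {β : Type}

/-! ### Oracle adversaries -/

/-- An *oracle adversary* with outputs in `β`: a (deterministic, transcript-style) oracle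
algorithm `alg` together with a polynomial coin budget `coins` and a polynomial round budget
`fuel` (both in the input length). Its run on input `x` draws `coins(|x|)` uniform coins `r` and
runs `alg` on `boolPair x r` for `fuel(|x|)` rounds (`OracleAdversary.outputPMF`). This is the
common shape of the adversary in PRF, CPA and CMA games.
[Goldreich 2001, §3.6 (Def. 3.6.4, probabilistic polynomial-time oracle machines);
Goldreich 2004, §5.4, §6.1; Arora–Barak 2009, Def. 7.1 with §3.4] [cite: Goldreich2001, §3.6 (Def. 3.6.4  probabilistic polynomi] -/
structure OracleAdversary (β : Type) where
  /-- The underlying deterministic oracle algorithm (coins read from the input). -/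
  alg : OracleAlg β
  /-- The number of coins used on inputs of length `n`, a polynomial. -/
  coins : Polynomial ℕ
  /-- The round budget (number of step evaluations) on inputs of length `n`, a polynomial. -/
  fuel : Polynomial ℕ

namespace OracleAdversary

/-- `𝒜.IsPPT eb`: the adversary is probabilistic polynomial-time — its step function is
polynomial-time (`OracleAlg.IsPolyTime`, outputs encoded by `eb`); the coin and round budgets
are polynomials by construction. [Goldreich 2001, §3.6, Def. 3.6.4; Arora–Barak 2009, §3.4] [cite: Goldreich2001, §3.6  Def. 3.6.4] -/
def IsPPT (𝒜 : OracleAdversary β) (eb : Encoding β Bool) : Prop :=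
  𝒜.alg.IsPolyTime eb

/-- The output law of the adversary `𝒜` with (deterministic) oracle `O` on input `x`:
`𝒜.alg.randRun O 𝒜.coins 𝒜.fuel x`. [Arora–Barak 2009, Def. 7.1 with §3.4;
Goldreich 2001, §3.6] [cite: AroraBarak2009, Def. 7.1 with §3.4] -/
noncomputable def outputPMF (𝒜 : OracleAdversary β) (O : Oracle) (x : List Bool) :
    PMF (Option β) :=
  𝒜.alg.randRun O 𝒜.coins 𝒜.fuel x

/-- The output law of the adversary `𝒜` on input `x` against an *indexed* oracle (the `i`-th
query answered by `O i`), over uniform coins `r ∈ {0,1}^{coins(|x|)}`: the push-forward of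
`r ↦ 𝒜.alg.runIdx O (fuel |x|) (boolPair x r)`. Used for encryption/signing oracles with
per-query fresh coins (the game first samples the oracle's coin blocks, then applies this).
[Goldreich 2004, §5.4.1, §6.1.3] [cite: Goldreich2004, §5.4.1  §6.1.3] -/
noncomputable def outputPMFIdx (𝒜 : OracleAdversary β) (O : ℕ → List Bool → List Bool)
    (x : List Bool) : PMF (Option β) :=
  (PMF.uniformOfFintype (List.Vector Bool (𝒜.coins.eval x.length))).map
    fun r => 𝒜.alg.runIdx O (𝒜.fuel.eval x.length) (boolPair x r.toList)

/-- `𝒜.acceptProb O n`: the probability (a real number in `[0,1]`) that the Boolean adversary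
`𝒜` with oracle `O` outputs `1` (i.e. `some true`) on the security parameter `1ⁿ`
(`unaryEncodeNat n`). [Goldreich 2001, §3.6, Def. 3.6.4 (`Pr[M^{F}(1ⁿ) = 1]`)] [cite: Goldreich2001, §3.6  Def. 3.6.4 ( Pr M^{F}(1ⁿ] -/
noncomputable def acceptProb (𝒜 : OracleAdversary Bool) (O : Oracle) (n : ℕ) : ℝ :=
  (𝒜.outputPMF O (unaryEncodeNat n) (some true)).toReal

/-- `𝒜.acceptProbIdx O n`: acceptance probability on `1ⁿ` against an indexed oracle.
[Goldreich 2004, §5.4.1] [cite: Goldreich2004, §5.4.1] -/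
noncomputable def acceptProbIdx (𝒜 : OracleAdversary Bool) (O : ℕ → List Bool → List Bool)
    (n : ℕ) : ℝ :=
  (𝒜.outputPMFIdx O (unaryEncodeNat n) (some true)).toReal

/-- Unfolding lemma: the output law is the push-forward of the uniform coins under the
deterministic run. [Arora–Barak 2009, Def. 7.1] [cite: AroraBarak2009, Def. 7.1] -/
theorem outputPMF_eq_map (𝒜 : OracleAdversary β) (O : Oracle) (x : List Bool) :
    𝒜.outputPMF O x =
      (PMF.uniformOfFintype (List.Vector Bool (𝒜.coins.eval x.length))).map
        fun r => 𝒜.alg.run O (𝒜.fuel.eval x.length) (boolPair x r.toList) :=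
  rfl

/-- Against a query-number-independent oracle the indexed output law is the plain one.
[Arora–Barak 2009, §3.4] [cite: AroraBarak2009, §3.4] -/
@[simp] theorem outputPMFIdx_const (𝒜 : OracleAdversary β) (O : Oracle) (x : List Bool) :
    𝒜.outputPMFIdx (fun _ => O) x = 𝒜.outputPMF O x := by
  simp only [outputPMFIdx, outputPMF, OracleAlg.randRun, OracleAlg.runIdx_const]

/-- Acceptance probabilities are nonnegative. [Goldreich 2001, §3.6] [cite: Goldreich2001, §3.6] -/
theorem acceptProb_nonneg (𝒜 : OracleAdversary Bool) (O : Oracle) (n : ℕ) :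
    0 ≤ 𝒜.acceptProb O n :=
  ENNReal.toReal_nonneg

/-- Acceptance probabilities are at most `1`. [Goldreich 2001, §3.6; Mathlib `PMF.coe_le_one`] [cite: Goldreich2001, §3.6] -/
theorem acceptProb_le_one (𝒜 : OracleAdversary Bool) (O : Oracle) (n : ℕ) :
    𝒜.acceptProb O n ≤ 1 :=
  ENNReal.toReal_le_of_le_ofReal zero_le_one (by simpa using PMF.coe_le_one _ _)

/-- Indexed acceptance probabilities are nonnegative. [Goldreich 2004, §5.4.1] [cite: Goldreich2004, §5.4.1] -/
theorem acceptProbIdx_nonneg (𝒜 : OracleAdversary Bool) (O : ℕ → List Bool → List Bool)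
    (n : ℕ) : 0 ≤ 𝒜.acceptProbIdx O n :=
  ENNReal.toReal_nonneg

/-- Indexed acceptance probabilities are at most `1`. [Goldreich 2004, §5.4.1] [cite: Goldreich2004, §5.4.1] -/
theorem acceptProbIdx_le_one (𝒜 : OracleAdversary Bool) (O : ℕ → List Bool → List Bool)
    (n : ℕ) : 𝒜.acceptProbIdx O n ≤ 1 :=
  ENNReal.toReal_le_of_le_ofReal zero_le_one (by simpa using PMF.coe_le_one _ _)

/-- `acceptProbIdx` against a constant indexed oracle is `acceptProb`. [Arora–Barak 2009, §3.4] [cite: AroraBarak2009, §3.4] -/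
@[simp] theorem acceptProbIdx_const (𝒜 : OracleAdversary Bool) (O : Oracle) (n : ℕ) :
    𝒜.acceptProbIdx (fun _ => O) n = 𝒜.acceptProb O n := by
  simp [acceptProbIdx, acceptProb]

end OracleAdversary

/-! ### Oracle builders -/

/-- `oracleOfFnAt m h`: the oracle answering queries of length exactly `m` by `h` and all other
(ill-formed) queries by the empty string `[]` (documented junk value). Used to give oracle
access to `F_k : {0,1}^{ℓ(n)} → {0,1}^*` in the PRF game. Plain function (`Oracle` is an
`abbrev`). [Goldreich 2001, §3.6.1 (length-preserving function ensembles), Def. 3.6.4] [cite: Goldreich2001, §3.6.1 (length-preserving function ensem] -/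
def oracleOfFnAt (m : ℕ) (h : List Bool → List Bool) : Oracle :=
  fun q => if q.length = m then h q else []

/-- `oracleOfTable H`: the oracle of a finite function table `H : {0,1}^a → {0,1}^b`; queries
of length `a` are answered by `H`, others by `[]` (documented junk value). Plain function.
[Goldreich–Goldwasser–Micali 1986, §3; Goldreich 2001, §3.6.1 (the uniform function ensemble
`H_n`)] [cite: GoldreichGoldwasserMicali1986, §3] -/
def oracleOfTable {a b : ℕ} (H : List.Vector Bool a → List.Vector Bool b) : Oracle :=
  fun q => if h : q.length = a then (H ⟨q, h⟩).toList else []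

/-- The uniformly random function `{0,1}^a → {0,1}^b` (a uniform element of the finite function
type; the ideal object of the PRF game). [Goldreich–Goldwasser–Micali 1986, §3; Goldreich 2001,
§3.6.1; Mathlib `PMF.uniformOfFintype`] [cite: GoldreichGoldwasserMicali1986, §3] -/
noncomputable def randomFunctionPMF (a b : ℕ) : PMF (List.Vector Bool a → List.Vector Bool b) :=
  PMF.uniformOfFintype _

/-- `oracleOfFnAt m h` answers a query of length `m` by `h`. [Goldreich 2001, §3.6.1] [cite: Goldreich2001, §3.6.1] -/
@[simp] theorem oracleOfFnAt_apply_of_length_eq {m : ℕ} (h : List Bool → List Bool)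
    {q : List Bool} (hq : q.length = m) : oracleOfFnAt m h q = h q := by
  simp [oracleOfFnAt, hq]

/-- `oracleOfFnAt m h` answers an ill-formed query by `[]`. [Goldreich 2001, §3.6.1] [cite: Goldreich2001, §3.6.1] -/
@[simp] theorem oracleOfFnAt_apply_of_length_ne {m : ℕ} (h : List Bool → List Bool)
    {q : List Bool} (hq : q.length ≠ m) : oracleOfFnAt m h q = [] := by
  simp [oracleOfFnAt, hq]

/-- `oracleOfTable H` answers a query of length `a` by the table. [GGM 1986, §3] [cite: GGM1986, §3] -/
@[simp] theorem oracleOfTable_apply_of_length_eq {a b : ℕ}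
    (H : List.Vector Bool a → List.Vector Bool b) {q : List Bool} (hq : q.length = a) :
    oracleOfTable H q = (H ⟨q, hq⟩).toList := by
  simp [oracleOfTable, hq]

/-- `oracleOfTable H` answers an ill-formed query by `[]`. [GGM 1986, §3] [cite: GGM1986, §3] -/
@[simp] theorem oracleOfTable_apply_of_length_ne {a b : ℕ}
    (H : List.Vector Bool a → List.Vector Bool b) {q : List Bool} (hq : q.length ≠ a) :
    oracleOfTable H q = [] := by
  simp [oracleOfTable, hq]

/-- On a vector query, `oracleOfTable H` returns the table entry. [GGM 1986, §3] [cite: GGM1986, §3] -/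
theorem oracleOfTable_toList {a b : ℕ} (H : List.Vector Bool a → List.Vector Bool b)
    (v : List.Vector Bool a) : oracleOfTable H v.toList = (H v).toList := by
  rw [oracleOfTable_apply_of_length_eq H v.toList_length]
  rfl

/-- Answers of `oracleOfTable H` to well-formed queries have length `b`. [GGM 1986, §3] [cite: GGM1986, §3] -/
theorem length_oracleOfTable_of_length_eq {a b : ℕ}
    (H : List.Vector Bool a → List.Vector Bool b) {q : List Bool} (hq : q.length = a) :
    (oracleOfTable H q).length = b := by
  rw [oracleOfTable_apply_of_length_eq H hq, List.Vector.toList_length]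

/-- Every function table has positive probability `1 / (2^b)^(2^a)` under `randomFunctionPMF`
(in particular the support is everything). [GGM 1986, §3; Mathlib
`PMF.uniformOfFintype_apply`] [cite: GGM1986, §3] -/
theorem randomFunctionPMF_apply (a b : ℕ) (H : List.Vector Bool a → List.Vector Bool b) :
    randomFunctionPMF a b H =
      ((Fintype.card (List.Vector Bool a → List.Vector Bool b) : ENNReal))⁻¹ :=
  PMF.uniformOfFintype_apply H

end Literature.Computability.Cryptography
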